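import Summits.AtomisticToContinuum.FouriersLaw.Theorems.ParityLiouvilleSeedLiouvilleForHeatObservables
import Summits.AtomisticToContinuum.FouriersLaw.Theorems.LocalOhmBVLocalOhmStubEquilibriumPackageAux4

/-!
# The harmonic telescoping identity in expectation (calibration helper NB1 of `LocalOhmBV.LocalOhm`)

Helper file (`--supports stmt-AtomisticToContinuum-12009`, route `LocalOhmBV`, decl `LocalOhm`, line
`registered`): the registered stub `harmonic_sum_integral_liouvilleZ_mul_bondCurrentZ` (harmonic-corner
calibration of the rigidity half). For `P = pinnedChain ω₂ 0 0 γ`, a shift-invariant DLR Gibbs state `μ`,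
a `C¹` polynomially bounded window profile `G` on `{a, …, a+n}` and bonds `z₁ + 2 ≤ a`, `a + n + 1 ≤ z₂`:
`Σ_{z=z₁}^{z₂} ∫ 𝒜(G ∘ box_{a,n}) · j_z dμ = -½ (∫ G(box) u_{z₁} dμ - ∫ G(box) u_{z₂+1} dμ)`,
`u_w = p_w² - ω₂ q_w² + (q_{w+1} - q_w)(q_w - q_{w-1})`. Proof (folklore calculus + Gibbs stationarity):
a small calculus of smooth cylinder functions `φ ∘ boxRestrictAt b K` (`φ ∈ C¹`) on a fixed box (sums,
products, additivity and Leibniz rule of `𝒜 = liouvilleZ P` from the box formula); Hamilton's equations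
give `𝒜 j_z = ½ (u_z - u_{z+1})`, telescoping `𝒜 Σ_z j_z = ½ (u_{z₁} - u_{z₂+1})`; Leibniz
`𝒜(G̃ J) = G̃ 𝒜J + J 𝒜G̃`; `∫ 𝒜(G̃ J) dμ = 0` by `integral_liouvilleZ_comp_boxRestrictAt_eq_zero` (`μ` is
time invariant, `isTimeInvariant_pinnedChain_of_isShiftInvariant`), the integrability side conditions
coming from the site moments of `μ` (moment algebra of `…LiouvilleForHeatStationarity`,
`integrable_comp_boxRestrictAt_of_polyBound`). Nothing here closes an item.
-/

set_option autoImplicit false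

noncomputable section

namespace Summit.AtomisticToContinuum.FouriersLaw.Theorems.LocalOhmBirth

open MeasureTheory Filter Topology
open scoped BigOperators
open Literature.MathematicalPhysics.KineticTheory
open Literature.MathematicalPhysics.KineticTheory.HeatConduction
open Summit.AtomisticToContinuum.FouriersLaw.Theorems.ParityLiouvilleSeed

/-! ### Smooth cylinder functions on a fixed box `{b, …, b+K}` -/

section BoxRep

variable {b : ℤ} {K : ℕ}

/-- The coordinates `q_x`, `p_x` of a site of the box are smooth cylinder functions on the box. [folklore] -/
theorem exists_boxRep_coord {x : ℤ} (h1 : b ≤ x) (h2 : x ≤ b + K) :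
    (∃ φ : (Fin (K + 1) → ℝ × ℝ) → ℝ, ContDiff ℝ 1 φ ∧ (fun σ : ChainConfig => (σ x).1) = φ ∘ boxRestrictAt b K) ∧
      ∃ φ : (Fin (K + 1) → ℝ × ℝ) → ℝ, ContDiff ℝ 1 φ ∧ (fun σ : ChainConfig => (σ x).2) = φ ∘ boxRestrictAt b K := by
  have hx : b + (((x - b).toNat : ℕ) : ℤ) = x := by omega
  refine ⟨⟨fun y => (y ⟨(x - b).toNat, by omega⟩).1, contDiff_fst.comp (contDiff_apply ℝ (ℝ × ℝ) _),
    funext fun σ => ?_⟩, ⟨fun y => (y ⟨(x - b).toNat, by omega⟩).2,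
      contDiff_snd.comp (contDiff_apply ℝ (ℝ × ℝ) _), funext fun σ => ?_⟩⟩
  · show (σ x).1 = (σ (b + (((x - b).toNat : ℕ) : ℤ))).1; rw [hx]
  · show (σ x).2 = (σ (b + (((x - b).toNat : ℕ) : ℤ))).2; rw [hx]

/-- Constants are smooth cylinder functions. [folklore] -/
theorem exists_boxRep_const (c : ℝ) :
    ∃ φ : (Fin (K + 1) → ℝ × ℝ) → ℝ, ContDiff ℝ 1 φ ∧ (fun _ : ChainConfig => c) = φ ∘ boxRestrictAt b K :=
  ⟨fun _ => c, contDiff_const, rfl⟩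

/-- Smooth cylinder functions on a box are closed under addition. [folklore] -/
theorem exists_boxRep_add {f g : ChainConfig → ℝ}
    (hf : ∃ φ : (Fin (K + 1) → ℝ × ℝ) → ℝ, ContDiff ℝ 1 φ ∧ f = φ ∘ boxRestrictAt b K)
    (hg : ∃ φ : (Fin (K + 1) → ℝ × ℝ) → ℝ, ContDiff ℝ 1 φ ∧ g = φ ∘ boxRestrictAt b K) :
    ∃ φ : (Fin (K + 1) → ℝ × ℝ) → ℝ, ContDiff ℝ 1 φ ∧ (fun σ => f σ + g σ) = φ ∘ boxRestrictAt b K := by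
  obtain ⟨φ, hφ, rfl⟩ := hf
  obtain ⟨ψ, hψ, rfl⟩ := hg
  exact ⟨fun y => φ y + ψ y, hφ.add hψ, rfl⟩

/-- Smooth cylinder functions on a box are closed under multiplication. [folklore] -/
theorem exists_boxRep_mul {f g : ChainConfig → ℝ}
    (hf : ∃ φ : (Fin (K + 1) → ℝ × ℝ) → ℝ, ContDiff ℝ 1 φ ∧ f = φ ∘ boxRestrictAt b K)
    (hg : ∃ φ : (Fin (K + 1) → ℝ × ℝ) → ℝ, ContDiff ℝ 1 φ ∧ g = φ ∘ boxRestrictAt b K) :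
    ∃ φ : (Fin (K + 1) → ℝ × ℝ) → ℝ, ContDiff ℝ 1 φ ∧ (fun σ => f σ * g σ) = φ ∘ boxRestrictAt b K := by
  obtain ⟨φ, hφ, rfl⟩ := hf
  obtain ⟨ψ, hψ, rfl⟩ := hg
  exact ⟨fun y => φ y * ψ y, hφ.mul hψ, rfl⟩

/-- Smooth cylinder functions on a box are closed under finite sums. [folklore] -/
theorem exists_boxRep_sum {ι : Type*} (s : Finset ι) {f : ι → ChainConfig → ℝ}
    (hf : ∀ k ∈ s, ∃ φ : (Fin (K + 1) → ℝ × ℝ) → ℝ, ContDiff ℝ 1 φ ∧ f k = φ ∘ boxRestrictAt b K) :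
    ∃ φ : (Fin (K + 1) → ℝ × ℝ) → ℝ, ContDiff ℝ 1 φ ∧ (fun σ => ∑ k ∈ s, f k σ) = φ ∘ boxRestrictAt b K := by
  classical
  induction s using Finset.induction_on with
  | empty => exact ⟨fun _ => 0, contDiff_const, funext fun σ => by simp⟩
  | insert a s has ih =>
    obtain ⟨φ, hφ, hφeq⟩ := hf a (Finset.mem_insert_self a s)
    obtain ⟨ψ, hψ, hψeq⟩ := ih fun k hk => hf k (Finset.mem_insert_of_mem hk)
    refine ⟨fun y => φ y + ψ y, hφ.add hψ, funext fun σ => ?_⟩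
    rw [Finset.sum_insert has, show f a σ = φ (boxRestrictAt b K σ) from congrFun hφeq σ,
      show ∑ k ∈ s, f k σ = ψ (boxRestrictAt b K σ) from congrFun hψeq σ]
    rfl

/-- **Re-boxing.** A `C¹` window profile on a sub-box `{a, …, a+n} ⊆ {b, …, b+K}` is a smooth cylinder
function on the big box (`G ∘ box_{a,n} = (G ∘ π) ∘ box_{b,K}`, `π` the coordinate projection). [folklore] -/
theorem exists_boxRep_window {a : ℤ} {n : ℕ} (h1 : b ≤ a) (h2 : a + n ≤ b + K)
    {G : (Fin (n + 1) → ℝ × ℝ) → ℝ} (hG : ContDiff ℝ 1 G) :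
    ∃ φ : (Fin (K + 1) → ℝ × ℝ) → ℝ, ContDiff ℝ 1 φ ∧ G ∘ boxRestrictAt a n = φ ∘ boxRestrictAt b K := by
  let idx : Fin (n + 1) → Fin (K + 1) := fun i => ⟨(a - b + i).toNat, by have := i.isLt; omega⟩
  have hidx : ∀ i : Fin (n + 1), b + ((idx i : ℕ) : ℤ) = a + i := fun i => by
    have := i.isLt; simp only [idx]; omega
  let π : (Fin (K + 1) → ℝ × ℝ) →L[ℝ] (Fin (n + 1) → ℝ × ℝ) :=
    ContinuousLinearMap.pi fun i => ContinuousLinearMap.proj (idx i)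
  refine ⟨G ∘ π, hG.comp π.contDiff, funext fun σ => ?_⟩
  simp only [Function.comp_apply]
  congr 1
  funext i
  simp only [boxRestrictAt_apply, π, ContinuousLinearMap.pi_apply, ContinuousLinearMap.proj_apply, hidx]

/-- **`𝒜` is additive on smooth cylinder functions of a common box.** [folklore] -/
theorem liouvilleZ_add_of_boxRep (P : OscillatorChain) {f g : ChainConfig → ℝ}
    (hf : ∃ φ : (Fin (K + 1) → ℝ × ℝ) → ℝ, ContDiff ℝ 1 φ ∧ f = φ ∘ boxRestrictAt b K)
    (hg : ∃ φ : (Fin (K + 1) → ℝ × ℝ) → ℝ, ContDiff ℝ 1 φ ∧ g = φ ∘ boxRestrictAt b K) (σ : ChainConfig) :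
    liouvilleZ P (fun σ => f σ + g σ) σ = liouvilleZ P f σ + liouvilleZ P g σ := by
  obtain ⟨φ, hφ, rfl⟩ := hf
  obtain ⟨ψ, hψ, rfl⟩ := hg
  have hd₁ : DifferentiableAt ℝ φ (boxRestrictAt b K σ) := (hφ.differentiable one_ne_zero) _
  have hd₂ : DifferentiableAt ℝ ψ (boxRestrictAt b K σ) := (hψ.differentiable one_ne_zero) _
  have hd : DifferentiableAt ℝ (fun y => φ y + ψ y) (boxRestrictAt b K σ) := hd₁.add hd₂
  have h : (fun σ => (φ ∘ boxRestrictAt b K) σ + (ψ ∘ boxRestrictAt b K) σ) =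
      (fun y => φ y + ψ y) ∘ boxRestrictAt b K := rfl
  rw [h, liouvilleZ_comp_boxRestrictAt P b K σ hd, liouvilleZ_comp_boxRestrictAt P b K σ hd₁,
    liouvilleZ_comp_boxRestrictAt P b K σ hd₂, ← Finset.sum_add_distrib]
  refine Finset.sum_congr rfl fun i _ => ?_
  rw [fderiv_fun_add hd₁ hd₂]
  simp only [add_apply]
  ring

/-- **Leibniz rule for `𝒜` on smooth cylinder functions of a common box**: `𝒜(fg) = f 𝒜g + g 𝒜f`. [folklore] -/
theorem liouvilleZ_mul_of_boxRep (P : OscillatorChain) {f g : ChainConfig → ℝ}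
    (hf : ∃ φ : (Fin (K + 1) → ℝ × ℝ) → ℝ, ContDiff ℝ 1 φ ∧ f = φ ∘ boxRestrictAt b K)
    (hg : ∃ φ : (Fin (K + 1) → ℝ × ℝ) → ℝ, ContDiff ℝ 1 φ ∧ g = φ ∘ boxRestrictAt b K) (σ : ChainConfig) :
    liouvilleZ P (fun σ => f σ * g σ) σ = f σ * liouvilleZ P g σ + g σ * liouvilleZ P f σ := by
  obtain ⟨φ, hφ, rfl⟩ := hf
  obtain ⟨ψ, hψ, rfl⟩ := hg
  have hd₁ : DifferentiableAt ℝ φ (boxRestrictAt b K σ) := (hφ.differentiable one_ne_zero) _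
  have hd₂ : DifferentiableAt ℝ ψ (boxRestrictAt b K σ) := (hψ.differentiable one_ne_zero) _
  have h : (fun σ => (φ ∘ boxRestrictAt b K) σ * (ψ ∘ boxRestrictAt b K) σ) =
      (fun y => φ y * ψ y) ∘ boxRestrictAt b K := rfl
  rw [h, liouvilleZ_mul_cutoff P b K σ hd₁ hd₂, ← liouvilleZ_comp_boxRestrictAt P b K σ hd₂]
  simp only [Function.comp_apply]
  ring

/-- `𝒜(c f) = c 𝒜f` on smooth cylinder functions. [folklore] -/
theorem liouvilleZ_const_mul_of_boxRep (P : OscillatorChain) (c : ℝ) {f : ChainConfig → ℝ}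
    (hf : ∃ φ : (Fin (K + 1) → ℝ × ℝ) → ℝ, ContDiff ℝ 1 φ ∧ f = φ ∘ boxRestrictAt b K) (σ : ChainConfig) :
    liouvilleZ P (fun σ => c * f σ) σ = c * liouvilleZ P f σ := by
  rw [liouvilleZ_mul_of_boxRep P (exists_boxRep_const (b := b) (K := K) c) hf σ, liouvilleZ_const]
  simp

/-- **`𝒜` commutes with finite sums** of smooth cylinder functions of a common box. [folklore] -/
theorem liouvilleZ_sum_of_boxRep (P : OscillatorChain) {ι : Type*} (s : Finset ι) {f : ι → ChainConfig → ℝ}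
    (hf : ∀ k ∈ s, ∃ φ : (Fin (K + 1) → ℝ × ℝ) → ℝ, ContDiff ℝ 1 φ ∧ f k = φ ∘ boxRestrictAt b K)
    (σ : ChainConfig) :
    liouvilleZ P (fun σ => ∑ k ∈ s, f k σ) σ = ∑ k ∈ s, liouvilleZ P (f k) σ := by
  classical
  induction s using Finset.induction_on with
  | empty => simp
  | insert a s has ih =>
    have hfs : ∀ k ∈ s, ∃ φ : (Fin (K + 1) → ℝ × ℝ) → ℝ, ContDiff ℝ 1 φ ∧ f k = φ ∘ boxRestrictAt b K :=
      fun k hk => hf k (Finset.mem_insert_of_mem hk)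
    have h : (fun σ => ∑ k ∈ insert a s, f k σ) = fun σ => f a σ + (fun σ => ∑ k ∈ s, f k σ) σ := by
      funext σ; rw [Finset.sum_insert has]
    rw [h, liouvilleZ_add_of_boxRep P (hf a (Finset.mem_insert_self a s)) (exists_boxRep_sum s hfs) σ, ih hfs,
      Finset.sum_insert has]

end BoxRep

/-- Telescoping over an integer interval: `Σ_{z=z₁}^{z₁+N} (f z - f (z+1)) = f z₁ - f (z₁+N+1)`. [folklore] -/
theorem sum_Icc_sub_succ_eq (f : ℤ → ℝ) (z₁ : ℤ) (N : ℕ) :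
    ∑ z ∈ Finset.Icc z₁ (z₁ + N), (f z - f (z + 1)) = f z₁ - f (z₁ + N + 1) := by
  induction N with
  | zero => simp
  | succ N ih =>
    have hc : z₁ + ((N + 1 : ℕ) : ℤ) = z₁ + N + 1 := by push_cast; ring
    rw [hc, ← Finset.insert_Icc_right_eq_Icc_add_one (by omega),
      Finset.sum_insert (by rw [Finset.mem_Icc]; omega), ih]
    ring

/-- Functions with all power moments are closed under finite sums. [folklore] -/
theorem moments_finset_sum {α ι : Type*} [MeasurableSpace α] {μ : Measure α} [IsFiniteMeasure μ]
    (s : Finset ι) {f : ι → α → ℝ} (hf : ∀ i ∈ s, ∀ n : ℕ, Integrable (fun a => f i a ^ n) μ) :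
    ∀ n : ℕ, Integrable (fun a => (∑ i ∈ s, f i a) ^ n) μ := by
  classical
  induction s using Finset.induction_on with
  | empty => intro n; simp only [Finset.sum_empty]; exact integrable_const _
  | insert a s has ih =>
    intro n
    refine (moments_add (hf a (Finset.mem_insert_self a s))
      (ih fun i hi => hf i (Finset.mem_insert_of_mem hi)) n).congr (Eventually.of_forall fun y => ?_)
    simp only [Finset.sum_insert has]

/-- The force of the harmonic chain `pinnedChain ω₂ 0 0 γ`: `F_x = -ω₂ q_x + (q_{x+1} - q_x) - (q_x - q_{x-1})`. [folklore] -/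
theorem pinnedChain_force_harmonic (ω₂ γ : ℝ) (σ : ChainConfig) (x : ℤ) :
    (pinnedChain ω₂ 0 0 γ).force σ x = -(ω₂ * (σ x).1) + ((σ (x + 1)).1 - (σ x).1) - ((σ x).1 - (σ (x - 1)).1) := by
  rw [CesaroUpgrade.pinnedChain_force_eq]
  ring

/-- The bond current of the harmonic chain: `j_x = -½ (p_x + p_{x+1})(q_{x+1} + (-1) q_x)`. [folklore] -/
theorem pinnedChain_bondCurrentZ_harmonic (ω₂ γ : ℝ) (σ : ChainConfig) (x : ℤ) :
    (pinnedChain ω₂ 0 0 γ).bondCurrentZ σ x =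
      -(1 / 2) * (((σ x).2 + (σ (x + 1)).2) * ((σ (x + 1)).1 + (-1) * (σ x).1)) := by
  rw [CesaroUpgrade.pinnedChain_bondCurrentZ_eq]
  ring

/-- The bond current `j_z` of the harmonic chain is a smooth cylinder function on every box containing
`z, z+1`. [folklore] -/
theorem exists_boxRep_bondCurrentZ_harmonic (ω₂ γ : ℝ) {b : ℤ} {K : ℕ} {z : ℤ} (h1 : b ≤ z)
    (h2 : z + 1 ≤ b + K) :
    ∃ φ : (Fin (K + 1) → ℝ × ℝ) → ℝ, ContDiff ℝ 1 φ ∧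
      (fun σ : ChainConfig => (pinnedChain ω₂ 0 0 γ).bondCurrentZ σ z) = φ ∘ boxRestrictAt b K := by
  have h0 := exists_boxRep_coord (b := b) (K := K) (x := z) h1 (by omega)
  have h1' := exists_boxRep_coord (b := b) (K := K) (x := z + 1) (by omega) h2
  obtain ⟨φ, hφ, hφeq⟩ := exists_boxRep_mul (exists_boxRep_const (-(1 / 2)))
    (exists_boxRep_mul (exists_boxRep_add h0.2 h1'.2)
      (exists_boxRep_add h1'.1 (exists_boxRep_mul (exists_boxRep_const (-1)) h0.1)))
  exact ⟨φ, hφ, (funext fun σ => pinnedChain_bondCurrentZ_harmonic ω₂ γ σ z).trans hφeq⟩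

/-- **`𝒜 j_z = ½ (u_z - u_{z+1})`** for the harmonic chain, `u_w = p_w² - ω₂ q_w² + (q_{w+1} - q_w)(q_w - q_{w-1})`
(Hamilton's equations `𝒜q = p`, `𝒜p = F` and the Leibniz rule). [folklore] -/
theorem liouvilleZ_bondCurrentZ_harmonic (ω₂ γ : ℝ) (z : ℤ) (σ : ChainConfig) :
    liouvilleZ (pinnedChain ω₂ 0 0 γ) (fun σ => (pinnedChain ω₂ 0 0 γ).bondCurrentZ σ z) σ =
      (1 / 2) * (((σ z).2 ^ 2 - ω₂ * (σ z).1 ^ 2 + ((σ (z + 1)).1 - (σ z).1) * ((σ z).1 - (σ (z - 1)).1)) -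
        ((σ (z + 1)).2 ^ 2 - ω₂ * (σ (z + 1)).1 ^ 2 +
          ((σ (z + 1 + 1)).1 - (σ (z + 1)).1) * ((σ (z + 1)).1 - (σ (z + 1 - 1)).1))) := by
  set P := pinnedChain ω₂ 0 0 γ with hP
  have hfun : (fun σ => P.bondCurrentZ σ z) =
      fun σ => -(1 / 2) * (((σ z).2 + (σ (z + 1)).2) * ((σ (z + 1)).1 + (-1) * (σ z).1)) :=
    funext fun σ => pinnedChain_bondCurrentZ_harmonic ω₂ γ σ z
  have h0 := exists_boxRep_coord (b := z) (K := 1) (x := z) le_rfl (by omega)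
  have h1 := exists_boxRep_coord (b := z) (K := 1) (x := z + 1) (by omega) (by push_cast; omega)
  have hmq := exists_boxRep_mul (exists_boxRep_const (-1)) h0.1
  have hS := exists_boxRep_add h0.2 h1.2
  have hR := exists_boxRep_add h1.1 hmq
  rw [hfun, liouvilleZ_const_mul_of_boxRep P _ (exists_boxRep_mul hS hR) σ, liouvilleZ_mul_of_boxRep P hS hR σ,
    liouvilleZ_add_of_boxRep P h0.2 h1.2 σ, liouvilleZ_add_of_boxRep P h1.1 hmq σ,
    liouvilleZ_const_mul_of_boxRep P _ h0.1 σ, liouvilleZ_position, liouvilleZ_position,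
    liouvilleZ_momentum, liouvilleZ_momentum, hP, pinnedChain_force_harmonic, pinnedChain_force_harmonic]
  simp only [add_sub_cancel_right]
  ring

/-- **`𝒜 Σ_{z=z₁}^{z₂} j_z = ½ (u_{z₁} - u_{z₂+1})`** for the harmonic chain (telescoping). [folklore] -/
theorem liouvilleZ_sum_bondCurrentZ_harmonic (ω₂ γ : ℝ) {z₁ z₂ : ℤ} (hz : z₁ ≤ z₂) (σ : ChainConfig) :
    liouvilleZ (pinnedChain ω₂ 0 0 γ)
        (fun σ => ∑ z ∈ Finset.Icc z₁ z₂, (pinnedChain ω₂ 0 0 γ).bondCurrentZ σ z) σ =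
      (1 / 2) * (((σ z₁).2 ^ 2 - ω₂ * (σ z₁).1 ^ 2 +
          ((σ (z₁ + 1)).1 - (σ z₁).1) * ((σ z₁).1 - (σ (z₁ - 1)).1)) -
        ((σ (z₂ + 1)).2 ^ 2 - ω₂ * (σ (z₂ + 1)).1 ^ 2 +
          ((σ (z₂ + 1 + 1)).1 - (σ (z₂ + 1)).1) * ((σ (z₂ + 1)).1 - (σ (z₂ + 1 - 1)).1))) := by
  have hrep : ∀ z ∈ Finset.Icc z₁ z₂, ∃ φ : (Fin ((z₂ + 1 - z₁).toNat + 1) → ℝ × ℝ) → ℝ, ContDiff ℝ 1 φ ∧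
      (fun σ : ChainConfig => (pinnedChain ω₂ 0 0 γ).bondCurrentZ σ z) =
        φ ∘ boxRestrictAt z₁ (z₂ + 1 - z₁).toNat := fun z hz => by
    rw [Finset.mem_Icc] at hz
    exact exists_boxRep_bondCurrentZ_harmonic ω₂ γ hz.1 (by omega)
  rw [liouvilleZ_sum_of_boxRep _ _ hrep σ]
  simp only [liouvilleZ_bondCurrentZ_harmonic]
  rw [← Finset.mul_sum]
  congr 1
  obtain ⟨N, hN⟩ : ∃ N : ℕ, z₂ = z₁ + N := ⟨(z₂ - z₁).toNat, by omega⟩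
  subst hN
  rw [sum_Icc_sub_succ_eq (fun w => (σ w).2 ^ 2 - ω₂ * (σ w).1 ^ 2 +
    ((σ (w + 1)).1 - (σ w).1) * ((σ w).1 - (σ (w - 1)).1)) z₁ N]

/-! ### The identity in expectation -/

/-- **NB1: the harmonic telescoping identity in expectation** (`lam = β = 0`): for a `C¹` polynomially
bounded window profile `G` on `{a,…,a+n}` and a range of bonds `[z₁, z₂]` covering `[a-2, a+n+1]`,
`Σ_{z=z₁}^{z₂} ∫ 𝒜(G ∘ box_{a,n}) · j_z dμ = -½ (∫ G(box) u_{z₁} dμ - ∫ G(box) u_{z₂+1} dμ)`,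
`u_w = p_w² - ω₂ q_w² + (q_{w+1} - q_w)(q_w - q_{w-1})` (from `𝒜 j_z = ½(u_z - u_{z+1})`, the Leibniz
rule and Gibbs stationarity `∫ 𝒜(G(box) · Σ_z j_z) dμ = 0`). [folklore] -/
theorem harmonic_sum_integral_liouvilleZ_mul_bondCurrentZ :
    ∀ ω₂ γ : ℝ, 0 < ω₂ → ∀ T : ℝ, 0 < T →
    ∀ μ : Measure ChainConfig, (pinnedChain ω₂ 0 0 γ).IsChainGibbsMeasure T μ → IsShiftInvariant μ →
    ∀ (a : ℤ) (n : ℕ) (G : (Fin (n + 1) → ℝ × ℝ) → ℝ), ContDiff ℝ 1 G →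
      (∃ (C₀ : ℝ) (m : ℕ), ∀ y, |G y| ≤ C₀ * (1 + ‖y‖) ^ m ∧ ‖fderiv ℝ G y‖ ≤ C₀ * (1 + ‖y‖) ^ m) →
    ∀ z₁ z₂ : ℤ, z₁ + 2 ≤ a → a + (n : ℤ) + 1 ≤ z₂ →
      ∑ z ∈ Finset.Icc z₁ z₂,
          ∫ σ, liouvilleZ (pinnedChain ω₂ 0 0 γ) (G ∘ boxRestrictAt a n) σ *
            (pinnedChain ω₂ 0 0 γ).bondCurrentZ σ z ∂μ =
        -(1 / 2) * ((∫ σ, G (boxRestrictAt a n σ) *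
            ((σ z₁).2 ^ 2 - ω₂ * (σ z₁).1 ^ 2 + ((σ (z₁ + 1)).1 - (σ z₁).1) * ((σ z₁).1 - (σ (z₁ - 1)).1)) ∂μ) -
          ∫ σ, G (boxRestrictAt a n σ) *
            ((σ (z₂ + 1)).2 ^ 2 - ω₂ * (σ (z₂ + 1)).1 ^ 2 +
              ((σ (z₂ + 1 + 1)).1 - (σ (z₂ + 1)).1) * ((σ (z₂ + 1)).1 - (σ (z₂ + 1 - 1)).1)) ∂μ) := by
  intro ω₂ γ hω T hT μ hμ hS a n G hG hGb z₁ z₂ hz₁ hz₂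
  obtain ⟨C₀, m, hC₀⟩ := hGb
  haveI : IsProbabilityMeasure μ := hμ.isProbabilityMeasure
  set u : ℤ → ChainConfig → ℝ := fun w σ => (σ w).2 ^ 2 - ω₂ * (σ w).1 ^ 2 +
    ((σ (w + 1)).1 - (σ w).1) * ((σ w).1 - (σ (w - 1)).1) with hu
  have hν : IsTimeInvariant (pinnedChain ω₂ 0 0 γ) μ :=
    OscillatorChain.isTimeInvariant_pinnedChain_of_isShiftInvariant γ hω le_rfl le_rfl hT hμ hS
  have hmom : ∀ (k : ℕ) (x : ℤ), Integrable (fun σ : ChainConfig => |(σ x).1| ^ k + |(σ x).2| ^ k) μ :=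
    fun k x => ((OscillatorChain.exists_integral_abs_pow_add_le_pinnedChain_of_isShiftInvariant γ hω le_rfl
      le_rfl hT hμ hS k).choose_spec x).1
  have Mq : ∀ x : ℤ, ∀ k : ℕ, Integrable (fun σ : ChainConfig => (σ x).1 ^ k) μ := fun x => moments_position hmom x
  have Mp : ∀ x : ℤ, ∀ k : ℕ, Integrable (fun σ : ChainConfig => (σ x).2 ^ k) μ := fun x => moments_momentum hmom x
  have MF : ∀ x : ℤ, ∀ k : ℕ, Integrable (fun σ : ChainConfig => (pinnedChain ω₂ 0 0 γ).force σ x ^ k) μ :=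
    fun x => moments_force ω₂ 0 0 γ hmom x
  have MG : ∀ k : ℕ, Integrable (fun σ : ChainConfig => G (boxRestrictAt a n σ) ^ k) μ := by
    intro k
    have hcont : Continuous fun y : Fin (n + 1) → ℝ × ℝ => G y ^ k := hG.continuous.pow k
    refine integrable_comp_boxRestrictAt_of_polyBound γ hω le_rfl le_rfl hT hμ hS a n hcont
      ⟨C₀ ^ k, m * k, fun y => ?_⟩
    rw [abs_pow, pow_mul, ← mul_pow]
    exact pow_le_pow_left₀ (abs_nonneg _) (hC₀ y).1 k
  have MDG : ∀ (i : Fin (n + 1)) (v : ℝ × ℝ), ‖v‖ ≤ 1 →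
      ∀ k : ℕ, Integrable (fun σ : ChainConfig => (fderiv ℝ G (boxRestrictAt a n σ) (Pi.single i v)) ^ k) μ := by
    intro i v hv k
    have hcont : Continuous fun y : Fin (n + 1) → ℝ × ℝ => (fderiv ℝ G y (Pi.single i v)) ^ k :=
      ((hG.continuous_fderiv one_ne_zero).clm_apply continuous_const).pow k
    refine integrable_comp_boxRestrictAt_of_polyBound γ hω le_rfl le_rfl hT hμ hS a n hcont
      ⟨C₀ ^ k, m * k, fun y => ?_⟩
    rw [abs_pow, pow_mul, ← mul_pow]
    refine pow_le_pow_left₀ (abs_nonneg _) ?_ k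
    rw [← Real.norm_eq_abs]
    exact (ContinuousLinearMap.le_opNorm _ _).trans
      ((mul_le_mul (hC₀ y).2 (norm_single_le_one i v hv) (norm_nonneg _)
        ((abs_nonneg _).trans (hC₀ y).1)).trans_eq (mul_one _))
  have MAG : ∀ k : ℕ, Integrable
      (fun σ : ChainConfig => (liouvilleZ (pinnedChain ω₂ 0 0 γ) (G ∘ boxRestrictAt a n) σ) ^ k) μ := by
    have h := moments_finset_sum (μ := μ) Finset.univ (f := fun (i : Fin (n + 1)) (σ : ChainConfig) =>
        (σ (a + i)).2 * fderiv ℝ G (boxRestrictAt a n σ) (Pi.single i (1, 0)) +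
          (pinnedChain ω₂ 0 0 γ).force σ (a + i) * fderiv ℝ G (boxRestrictAt a n σ) (Pi.single i (0, 1)))
      fun i _ => moments_add (moments_mul (Mp (a + i)) (MDG i (1, 0) (by simp [Prod.norm_def])))
        (moments_mul (MF (a + i)) (MDG i (0, 1) (by simp [Prod.norm_def])))
    intro k
    refine (h k).congr (Eventually.of_forall fun σ => ?_)
    simp only [liouvilleZ_comp_boxRestrictAt _ a n σ ((hG.differentiable one_ne_zero) _)]
  have Mj : ∀ z : ℤ, ∀ k : ℕ, Integrable (fun σ : ChainConfig => (pinnedChain ω₂ 0 0 γ).bondCurrentZ σ z ^ k) μ := by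
    intro z k
    refine (moments_const_mul (moments_mul (moments_add (Mp z) (Mp (z + 1)))
      (moments_add (Mq (z + 1)) (moments_const_mul (Mq z) (-1)))) (-(1 / 2)) k).congr
      (Eventually.of_forall fun σ => ?_)
    simp only [pinnedChain_bondCurrentZ_harmonic]
  have MJ : ∀ k : ℕ, Integrable (fun σ : ChainConfig =>
      (∑ z ∈ Finset.Icc z₁ z₂, (pinnedChain ω₂ 0 0 γ).bondCurrentZ σ z) ^ k) μ :=
    moments_finset_sum _ fun z _ => Mj z
  have Mu : ∀ w : ℤ, ∀ k : ℕ, Integrable (fun σ : ChainConfig => u w σ ^ k) μ := fun w =>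
    moments_add (moments_sub (moments_pow (Mp w) 2) (moments_const_mul (moments_pow (Mq w) 2) ω₂))
      (moments_mul (moments_sub (Mq (w + 1)) (Mq w)) (moments_sub (Mq w) (Mq (w - 1))))
  -- the common box `{z₁, …, z₂ + 1}` and the cylinder representations of `G ∘ box` and `J = Σ_z j_z`
  set K : ℕ := (z₂ + 1 - z₁).toNat with hK
  have hGrep : ∃ φ : (Fin (K + 1) → ℝ × ℝ) → ℝ, ContDiff ℝ 1 φ ∧ G ∘ boxRestrictAt a n = φ ∘ boxRestrictAt z₁ K :=
    exists_boxRep_window (by omega) (by omega) hG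
  have hJrep : ∃ φ : (Fin (K + 1) → ℝ × ℝ) → ℝ, ContDiff ℝ 1 φ ∧
      (fun σ : ChainConfig => ∑ z ∈ Finset.Icc z₁ z₂, (pinnedChain ω₂ 0 0 γ).bondCurrentZ σ z) =
        φ ∘ boxRestrictAt z₁ K :=
    exists_boxRep_sum _ fun z hz => exists_boxRep_bondCurrentZ_harmonic ω₂ γ (Finset.mem_Icc.1 hz).1
      (by have := (Finset.mem_Icc.1 hz).2; omega)
  obtain ⟨Φ, hΦ, hΦeq⟩ := exists_boxRep_mul hGrep hJrep
  have hΦσ : ∀ σ, Φ (boxRestrictAt z₁ K σ) =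
      G (boxRestrictAt a n σ) * ∑ z ∈ Finset.Icc z₁ z₂, (pinnedChain ω₂ 0 0 γ).bondCurrentZ σ z := fun σ => by
    simpa only [Function.comp_apply] using (congrFun hΦeq σ).symm
  -- Leibniz rule and `𝒜 J = ½ (u_{z₁} - u_{z₂+1})`, pointwise
  have hLeib : ∀ σ, liouvilleZ (pinnedChain ω₂ 0 0 γ) (Φ ∘ boxRestrictAt z₁ K) σ =
      G (boxRestrictAt a n σ) * ((1 / 2) * (u z₁ σ - u (z₂ + 1) σ)) +
        (∑ z ∈ Finset.Icc z₁ z₂, (pinnedChain ω₂ 0 0 γ).bondCurrentZ σ z) *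
          liouvilleZ (pinnedChain ω₂ 0 0 γ) (G ∘ boxRestrictAt a n) σ := fun σ => by
    rw [← hΦeq, liouvilleZ_mul_of_boxRep _ hGrep hJrep σ, liouvilleZ_sum_bondCurrentZ_harmonic ω₂ γ (by omega) σ]
    rfl
  have hA_int : Integrable (fun σ : ChainConfig => G (boxRestrictAt a n σ) * ((1 / 2) * (u z₁ σ - u (z₂ + 1) σ))) μ :=
    integrable_mul_of_moments MG (moments_const_mul (moments_sub (Mu z₁) (Mu (z₂ + 1))) (1 / 2))
  have hB_int : Integrable (fun σ : ChainConfig =>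
      (∑ z ∈ Finset.Icc z₁ z₂, (pinnedChain ω₂ 0 0 γ).bondCurrentZ σ z) *
        liouvilleZ (pinnedChain ω₂ 0 0 γ) (G ∘ boxRestrictAt a n) σ) μ :=
    integrable_mul_of_moments MJ MAG
  have hint : Integrable (liouvilleZ (pinnedChain ω₂ 0 0 γ) (Φ ∘ boxRestrictAt z₁ K)) μ :=
    (hA_int.add hB_int).congr (Eventually.of_forall fun σ => (hLeib σ).symm)
  have henv : Integrable (fun σ => |Φ (boxRestrictAt z₁ K σ)| *
      ∑ i : Fin (K + 1), (|(σ (z₁ + i)).2| + |(pinnedChain ω₂ 0 0 γ).force σ (z₁ + i)|)) μ := by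
    have h := integrable_mul_of_moments (moments_abs (moments_mul MG MJ))
      (moments_finset_sum (μ := μ) Finset.univ (f := fun (i : Fin (K + 1)) (σ : ChainConfig) =>
          |(σ (z₁ + i)).2| + |(pinnedChain ω₂ 0 0 γ).force σ (z₁ + i)|)
        fun i _ => moments_add (moments_abs (Mp (z₁ + i))) (moments_abs (MF (z₁ + i))))
    refine h.congr (Eventually.of_forall fun σ => ?_)
    simp only [hΦσ]
  -- Gibbs stationarity for the unbounded `C¹` profile `Φ`: `∫ 𝒜Φ dμ = 0`, and evaluation of `∫ 𝒜Φ dμ`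
  have h0 : (∫ σ, G (boxRestrictAt a n σ) * ((1 / 2) * (u z₁ σ - u (z₂ + 1) σ)) ∂μ) +
      ∫ σ, (∑ z ∈ Finset.Icc z₁ z₂, (pinnedChain ω₂ 0 0 γ).bondCurrentZ σ z) *
        liouvilleZ (pinnedChain ω₂ 0 0 γ) (G ∘ boxRestrictAt a n) σ ∂μ = 0 := by
    rw [← integral_add hA_int hB_int]
    exact (integral_congr_ae (Eventually.of_forall fun σ => (hLeib σ).symm)).trans
      (integral_liouvilleZ_comp_boxRestrictAt_eq_zero (pinnedChain ω₂ 0 0 γ) hν z₁ K hΦ hint henv)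
  have hA : ∫ σ, G (boxRestrictAt a n σ) * ((1 / 2) * (u z₁ σ - u (z₂ + 1) σ)) ∂μ =
      (1 / 2) * ((∫ σ, G (boxRestrictAt a n σ) * u z₁ σ ∂μ) - ∫ σ, G (boxRestrictAt a n σ) * u (z₂ + 1) σ ∂μ) := by
    rw [← integral_sub (integrable_mul_of_moments MG (Mu z₁)) (integrable_mul_of_moments MG (Mu (z₂ + 1))),
      ← integral_const_mul]
    exact integral_congr_ae (Eventually.of_forall fun σ => by ring)
  have hB : ∫ σ, (∑ z ∈ Finset.Icc z₁ z₂, (pinnedChain ω₂ 0 0 γ).bondCurrentZ σ z) *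
        liouvilleZ (pinnedChain ω₂ 0 0 γ) (G ∘ boxRestrictAt a n) σ ∂μ =
      ∑ z ∈ Finset.Icc z₁ z₂, ∫ σ, liouvilleZ (pinnedChain ω₂ 0 0 γ) (G ∘ boxRestrictAt a n) σ *
        (pinnedChain ω₂ 0 0 γ).bondCurrentZ σ z ∂μ := by
    rw [← integral_finsetSum _ fun z _ => integrable_mul_of_moments MAG (Mj z)]
    refine integral_congr_ae (Eventually.of_forall fun σ => ?_)
    simp only [Finset.sum_mul]
    exact Finset.sum_congr rfl fun z _ => mul_comm _ _
  rw [hA, hB] at h0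
  simp only [hu] at h0
  linarith

end Summit.AtomisticToContinuum.FouriersLaw.Theorems.LocalOhmBirth

end
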